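import Mathlib.Algebra.MvPolynomial.PDeriv
import Mathlib.Algebra.MvPolynomial.CommRing
import Mathlib.RingTheory.MvPolynomial.Homogeneous

/-!
# Weight operators `Σ_i s_i X_i ∂_i` on multivariate polynomials

Topic `Literature/RingTheory/MvPolynomial`.  For a commutative ring `R`, variables `σ` and integer
weights `s : σ → ℤ`, the **weight operator**

`weightOp s = Σ_i s_i · X_i ∂/∂X_i : R[X_σ] → R[X_σ]`

is the polynomial (Lie-algebra) part of the action of the one-parameter diagonal torus
`t ↦ diag(t^{s_i})`: `f(t^{s} · X) = Σ_m t^{wt s m} coeff_m f · X^m`, differentiated at `t = 1`.  It is a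
derivation, diagonal on monomials with eigenvalue the weight `wt s m = Σ_i s_i m_i` (`coeff_weightOp`,
`weightOp_monomial`), so that

* an eigenvector `weightOp s f = n • f` has all its monomials of weight `n`
  (`wt_eq_of_weightOp_eq_smul`; special cases `n = 0`, `n = 1`);
* `weightOp s` satisfies the Leibniz rule and kills constants (`weightOp_mul`, `weightOp_C`,
  `weightOp_pow`);
* the Euler operator `E = Σ_i X_i ∂_i` is `weightOp 1`, a sum of complementary weight operators is
  again a weight operator (`weightOp_add_weights`), and a polynomial killed by `E` over a ring of
  characteristic zero is a constant (`eq_C_of_euler_eq_zero`), more generally a polynomial killed by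
  a family of weight operators whose weights jointly dominate the Euler weights is constant
  (`eq_C_of_forall_weightOp_eq_zero`).

These are the standard first facts about infinitesimal torus actions on polynomial rings
(weight-space decomposition of `R[X_σ]` under a diagonal torus; Euler's identity, for which see also
Mathlib's `MvPolynomial.IsWeightedHomogeneous.sum_weight_X_mul_pderiv`).  All statements are
folklore; the file reproduces, in Mathlib's generality, §0 and §E of the `pub-hodgecm` cell package
file `HodgeCM/PerL34/ArchB.lean` (there over `ℂ`).

## Mathlib / tree

Mathlib has `MvPolynomial.pderiv`, Euler's identity for weighted-homogeneous polynomials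
(`RingTheory/MvPolynomial/EulerIdentity`) and weighted homogeneity (`IsWeightedHomogeneous`, with
weights in an additive monoid), but no named weight/number operator and no "eigenvector ⇒ support
on one weight" lemma; the tree's `Literature.Algebra.Polynomial.coeff_X_mul_pderiv`
(`FischerNumberOperator`) is the case `R = ℝ` of `coeff_X_mul_pderiv` below.
-/

namespace Literature.RingTheory.MvPolynomial

open _root_.MvPolynomial
open scoped BigOperators

noncomputable section

/-! ### The number operators `X_i ∂_i` -/

section Semiring

variable {σ R : Type*} [CommSemiring R]

/-- `coeff_m (X_i · ∂_i f) = m_i · coeff_m f`: the number operator `X_i ∂_i` is diagonal on monomials.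
[folklore] -/
theorem coeff_X_mul_pderiv (i : σ) (f : MvPolynomial σ R) (m : σ →₀ ℕ) :
    coeff m (X i * pderiv i f) = (m i : R) * coeff m f := by
  classical
  induction f using MvPolynomial.induction_on' with
  | monomial u a =>
      rw [X_mul_pderiv_monomial, coeff_smul, coeff_monomial]
      split_ifs with h
      · subst h; simp [nsmul_eq_mul]
      · simp
  | add p q hp hq => simp only [map_add, mul_add, coeff_add, hp, hq]

/-- `X_i ∂_i (X^m) = m_i · X^m`. [folklore] -/
theorem X_mul_pderiv_monomial' (i : σ) (m : σ →₀ ℕ) (a : R) :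
    X i * pderiv i (monomial m a) = (m i : R) • monomial m a := by
  classical
  ext m'
  rw [coeff_X_mul_pderiv, coeff_smul, coeff_monomial, smul_eq_mul]
  split_ifs with h
  · subst h; rfl
  · rw [mul_zero, mul_zero]

end Semiring

/-! ### Weights and weight operators -/

section Ring

variable {σ R : Type*} [Fintype σ] [CommRing R]

/-- The weight `Σ_i s_i m_i ∈ ℤ` of a monomial (exponent vector) `m` for integer weights `s` on the
variables. [folklore] -/
def wt (s : σ → ℤ) (m : σ →₀ ℕ) : ℤ := ∑ i, s i * (m i : ℤ)

omit [Fintype σ] in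
/-- [folklore] -/
theorem wt_def [Fintype σ] (s : σ → ℤ) (m : σ →₀ ℕ) : wt s m = ∑ i, s i * (m i : ℤ) := rfl

/-- The weight is additive in the monomial. [folklore] -/
theorem wt_add (s : σ → ℤ) (m m' : σ →₀ ℕ) : wt s (m + m') = wt s m + wt s m' := by
  simp only [wt, Finsupp.add_apply, Nat.cast_add, mul_add, Finset.sum_add_distrib]

/-- The weight is additive in the weights. [folklore] -/
theorem wt_add_weights (s s' : σ → ℤ) (m : σ →₀ ℕ) : wt (s + s') m = wt s m + wt s' m := by
  simp only [wt, Pi.add_apply, add_mul, Finset.sum_add_distrib]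

/-- [folklore] -/
@[simp] theorem wt_zero (s : σ → ℤ) : wt s 0 = 0 := by simp [wt]

/-- [folklore] -/
theorem wt_single [DecidableEq σ] (s : σ → ℤ) (i : σ) (n : ℕ) :
    wt s (Finsupp.single i n) = s i * n := by
  classical
  rw [wt, Finset.sum_eq_single i]
  · rw [Finsupp.single_eq_same]
  · intro j _ hj; rw [Finsupp.single_eq_of_ne hj]; simp
  · intro h; exact absurd (Finset.mem_univ i) h

/-- The weight operator `Σ_i s_i X_i ∂_i` — the polynomial part of the infinitesimal action of the
one-parameter diagonal torus with exponents `s`. [folklore] -/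
def weightOp (s : σ → ℤ) : MvPolynomial σ R →ₗ[R] MvPolynomial σ R :=
  ∑ i, (s i : R) • (LinearMap.mulLeft R (X i : MvPolynomial σ R) ∘ₗ (pderiv i).toLinearMap)

/-- [folklore] -/
theorem weightOp_apply (s : σ → ℤ) (f : MvPolynomial σ R) :
    weightOp s f = ∑ i, (s i : R) • (X i * pderiv i f) := by
  simp [weightOp, LinearMap.sum_apply]

/-- Weight operators are diagonal on monomials with eigenvalue the weight:
`coeff_m (weightOp s f) = (wt s m) · coeff_m f`. [folklore] -/
theorem coeff_weightOp (s : σ → ℤ) (f : MvPolynomial σ R) (m : σ →₀ ℕ) :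
    coeff m (weightOp s f) = (wt s m : R) * coeff m f := by
  rw [weightOp_apply, coeff_sum]
  simp only [coeff_smul, smul_eq_mul, coeff_X_mul_pderiv, ← mul_assoc]
  rw [← Finset.sum_mul, wt]
  push_cast
  rfl

/-- `weightOp s (a X^m) = (wt s m) · a X^m`. [folklore] -/
theorem weightOp_monomial (s : σ → ℤ) (m : σ →₀ ℕ) (a : R) :
    weightOp s (monomial m a) = (wt s m : R) • monomial m a := by
  classical
  ext m'
  rw [coeff_weightOp, coeff_smul, coeff_monomial, smul_eq_mul]
  split_ifs with h
  · subst h; rfl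
  · rw [mul_zero, mul_zero]

/-- The weight operator is linear in the weights. [folklore] -/
theorem weightOp_add_weights (s s' : σ → ℤ) :
    (weightOp (s + s') : MvPolynomial σ R →ₗ[R] MvPolynomial σ R) = weightOp s + weightOp s' := by
  refine LinearMap.ext fun f => MvPolynomial.ext _ _ fun m => ?_
  simp only [LinearMap.add_apply, coeff_add, coeff_weightOp, wt_add_weights, Int.cast_add, add_mul]

/-- Weight operators kill constants. [folklore] -/
@[simp] theorem weightOp_C (s : σ → ℤ) (a : R) : weightOp s (C a : MvPolynomial σ R) = 0 := by
  rw [weightOp_apply]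
  exact Finset.sum_eq_zero fun i _ => by rw [pderiv_C, mul_zero, smul_zero]

/-- [folklore] -/
@[simp] theorem weightOp_one (s : σ → ℤ) : weightOp s (1 : MvPolynomial σ R) = 0 := by
  rw [← C_1]; exact weightOp_C s 1

/-- Leibniz rule: weight operators are derivations. [folklore] -/
theorem weightOp_mul (s : σ → ℤ) (p q : MvPolynomial σ R) :
    weightOp s (p * q) = weightOp s p * q + p * weightOp s q := by
  simp only [weightOp_apply, Derivation.leibniz, smul_eq_mul, MvPolynomial.smul_eq_C_mul,
    Finset.sum_mul, Finset.mul_sum, ← Finset.sum_add_distrib]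
  refine Finset.sum_congr rfl fun i _ => ?_
  ring

/-- `weightOp s (p^n) = n p^{n-1} · weightOp s p`. [folklore] -/
theorem weightOp_pow (s : σ → ℤ) (p : MvPolynomial σ R) (n : ℕ) :
    weightOp s (p ^ n) = (n : MvPolynomial σ R) * p ^ (n - 1) * weightOp s p := by
  induction n with
  | zero => simp
  | succ n ih =>
    rw [pow_succ, weightOp_mul, ih]
    rcases n with _ | n
    · simp
    · rw [Nat.add_sub_cancel, show n + 1 + 1 - 1 = n + 1 from rfl, pow_succ]
      push_cast
      ring

/-- The weight operator as an `R`-derivation of `R[X_σ]`. [folklore] -/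
def weightDerivation (s : σ → ℤ) : Derivation R (MvPolynomial σ R) (MvPolynomial σ R) where
  toLinearMap := weightOp s
  map_one_eq_zero' := weightOp_one s
  leibniz' p q := by
    change weightOp s (p * q) = p • weightOp s q + q • weightOp s p
    rw [weightOp_mul, smul_eq_mul, smul_eq_mul]; ring

/-- [folklore] -/
@[simp] theorem weightDerivation_apply (s : σ → ℤ) (f : MvPolynomial σ R) :
    weightDerivation s f = weightOp s f := rfl

end Ring

/-! ### Eigenvectors: support on one weight -/

section Domain

variable {σ R : Type*} [Fintype σ] [CommRing R] [IsDomain R] [CharZero R]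

/-- If `f` is an eigenvector of the weight operator with integer eigenvalue `n`, every monomial of
`f` has weight `n`. [folklore] -/
theorem wt_eq_of_weightOp_eq_smul {s : σ → ℤ} {f : MvPolynomial σ R} {n : ℤ}
    (h : weightOp s f = (n : R) • f) {m : σ →₀ ℕ} (hm : m ∈ f.support) : wt s m = n := by
  have hc : coeff m f ≠ 0 := MvPolynomial.mem_support_iff.mp hm
  have h1 := congrArg (coeff m) h
  rw [coeff_weightOp, coeff_smul, smul_eq_mul] at h1
  exact_mod_cast mul_right_cancel₀ hc h1

/-- A polynomial killed by a weight operator is supported on monomials of weight `0`. [folklore] -/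
theorem wt_eq_zero_of_weightOp_eq_zero {s : σ → ℤ} {f : MvPolynomial σ R}
    (h : weightOp s f = 0) {m : σ →₀ ℕ} (hm : m ∈ f.support) : wt s m = 0 := by
  have h' : weightOp s f = ((0 : ℤ) : R) • f := by rw [h]; simp
  exact wt_eq_of_weightOp_eq_smul h' hm

/-- A polynomial fixed by a weight operator is supported on monomials of weight `1`. [folklore] -/
theorem wt_eq_one_of_weightOp_eq_self {s : σ → ℤ} {f : MvPolynomial σ R}
    (h : weightOp s f = f) {m : σ →₀ ℕ} (hm : m ∈ f.support) : wt s m = 1 := by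
  have h' : weightOp s f = ((1 : ℤ) : R) • f := by rw [h]; simp
  exact wt_eq_of_weightOp_eq_smul h' hm

/-- Conversely, a polynomial supported on monomials of weight `n` is an eigenvector with eigenvalue
`n` (over any commutative ring). [folklore] -/
theorem weightOp_eq_smul_of_wt_eq {R' : Type*} [CommRing R'] {s : σ → ℤ} {f : MvPolynomial σ R'}
    {n : ℤ} (h : ∀ m ∈ f.support, wt s m = n) : weightOp s f = (n : R') • f := by
  ext m
  rw [coeff_weightOp, coeff_smul, smul_eq_mul]
  by_cases hm : m ∈ f.support
  · rw [h m hm]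
  · rw [MvPolynomial.notMem_support_iff.mp hm, mul_zero, mul_zero]

end Domain

/-! ### Euler-type operators kill only constants -/

section Euler

variable {σ R : Type*} [Fintype σ] [CommRing R]

omit [Fintype σ] in
/-- A polynomial whose support is contained in `{0}` is a constant. [folklore] -/
theorem eq_C_of_support_subset_zero {f : MvPolynomial σ R} (h : ∀ m ∈ f.support, m = 0) :
    f = C (coeff 0 f) := by
  classical
  ext m
  rw [coeff_C]
  split_ifs with h0
  · subst h0; rfl
  · by_contra hne
    exact h0 (h m (MvPolynomial.mem_support_iff.mpr hne)).symm

/-- The Euler weight (all weights `1`) of `m` is its degree `|m|`. [folklore] -/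
theorem wt_one (m : σ →₀ ℕ) : wt (1 : σ → ℤ) m = (m.degree : ℤ) := by
  simp only [wt, Pi.one_apply, one_mul, Finsupp.degree_eq_sum]
  push_cast
  rfl

variable [IsDomain R] [CharZero R]

/-- **The Euler operator kills only constants**: if `Σ_i X_i ∂_i f = 0` then `f` is constant (over a
domain of characteristic zero). [folklore] -/
theorem eq_C_of_euler_eq_zero {f : MvPolynomial σ R} (h : weightOp (1 : σ → ℤ) f = 0) :
    f = C (coeff 0 f) := by
  refine eq_C_of_support_subset_zero fun m hm => ?_
  have h0 := wt_eq_zero_of_weightOp_eq_zero h hm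
  rw [wt_one] at h0
  exact (Finsupp.degree_eq_zero_iff m).mp (by exact_mod_cast h0)

/-- More generally: if `f` is killed by weight operators `weightOp (s k)`, `k ∈ K`, and some
`ℤ`-combination of the `s k` has all weights POSITIVE, then `f` is constant.  (E.g. the Euler
operator is the sum of the weight operators of a partition of the variables.) [folklore] -/
theorem eq_C_of_forall_weightOp_eq_zero {K : Type*} (s : K → σ → ℤ) (c : K →₀ ℤ)
    (hpos : ∀ i, 0 < ∑ k ∈ c.support, c k * s k i) {f : MvPolynomial σ R}
    (h : ∀ k ∈ c.support, weightOp (s k) f = 0) : f = C (coeff 0 f) := by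
  refine eq_C_of_support_subset_zero fun m hm => ?_
  have hk : ∀ k ∈ c.support, wt (s k) m = 0 := fun k hk => wt_eq_zero_of_weightOp_eq_zero (h k hk) hm
  -- the positive combination of the weights vanishes on `m`, forcing `m = 0`
  have hsum : ∑ i, (∑ k ∈ c.support, c k * s k i) * (m i : ℤ) = 0 := by
    have : ∑ k ∈ c.support, c k * wt (s k) m = 0 :=
      Finset.sum_eq_zero fun k hk' => by rw [hk k hk', mul_zero]
    rw [← this]
    simp only [wt, Finset.mul_sum, Finset.sum_mul, mul_assoc]
    rw [Finset.sum_comm]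
  ext i
  have hle : ∀ j ∈ (Finset.univ : Finset σ), 0 ≤ (∑ k ∈ c.support, c k * s k j) * (m j : ℤ) :=
    fun j _ => mul_nonneg (hpos j).le (by positivity)
  have := (Finset.sum_eq_zero_iff_of_nonneg hle).mp hsum i (Finset.mem_univ i)
  rcases mul_eq_zero.mp this with h1 | h2
  · exact absurd h1 (hpos i).ne'
  · exact_mod_cast h2

end Euler

end

end Literature.RingTheory.MvPolynomial
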